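import Summits.KontsevichZagierPeriods.Zeta5Search.Barrier.ConeGammaPeriodDecomposition
import Summits.KontsevichZagierPeriods.Zeta5Search.Barrier.ConeGammaLogCuspUniform

/-!
# ζ(5) search — BARRIER: `Φ` IS LOG-LIPSCHITZ AT EVERY RATIONAL DIRECTION — the covering ball is reached, hypothesis-free

HONEST FRAMING (cell `pub-zeta5`): systematic search; no irrationality claim unless kernel-certified. MODEL objects
under Brown–Zudilin's (28)+(30) accounting ([BZ22] = arXiv:2210.03391; (28) observed, not proved); nothing here is a
statement about `ζ(5)`, any `γ` of record, the cone's supremum (C2 = `BarrierC2` OPEN) or the value / sign of the cusp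
slope at a named direction. The constants below are the NO-CANCELLATION constants of the `σ₁`-scale (lead/lit g27
`SE-DESK-NOTE.md` §2; `σ₁(η) = Σ_k |φ_k(η)| ≤ 28·Y(η)`), NOT the signed-jump-mass constants of the conjectured lemma
S-E (`BARRIER-PLAN.md` §2b), and they grow like `log T` with the period: at the census's covering levels they exceed
the §2b plausibility budget, so NOTHING is certified at any direction and no number or sentence of record moves; S-E
(an `O(1)` constant from the signed jump masses, uniformly in the level) stays CONJECTURED; records in print UNMOVED.
ARITHMETIC READING (DATA, not a certificate, in no statement; lead/lit g40 GO INBOX l.9789 (a)): at the covering radius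
`ρ = 1/(2λ₀)` and a generic transversal displacement (`σ₁ ≈ 30‖η‖`) the modulus below is `≈ 2.8 / 1.4 / 0.4` nats at
`λ₀ = 60 / 120 / 480`, i.e. `≈ 0.4 / 0.2 / 0.06` in `γ` through `∂γ/∂Φ ≈ 0.135` — against the §2b budget `0.03`: NOT a
usable bound, nothing certified. Prover P2 g39 (self-selected Lean-only item of the P2 lineage; plan INBOX l.9788, GO +
words «LOGLIPSCHITZ» + conditions (a)–(g) l.9789), file (1) of two.

THE POINT. Every kernel expansion of the MODEL saving `Φ = phi30` around a rational direction so far (P2 g19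
`phi30_logCusp`, g37 `phi30_logCusp_nhds`, g38) lives on Lemma B's COHERENCE ball, whose radius is the least
breakpoint gap of the period (DATA: `3e−5 … 6e−7` at the four named directions, short of S-E's covering radius
`1/(2λ₀)` by factors `300–3500`), and `ConeGammaContinuity` records «any modulus of continuity» as NOT in the kernel.
But P2 g20's desk-note identity `abs_phi30_sub_sub_periodSum_le` is HYPOTHESIS-FREE on the whole range `T·Y ≤ 1`,
`Y ≤ x_min/2`, and P2 g29's `abs_translateIntegral_sub_le` bounds every static translate defect:
`|P(t·δ) − P(0)| ≤ t·T·σ₁(δ)`. Feeding the second into the first (the static period sum is at most `ε·σ₁·H_N`,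
`H_N ≤ 1 + log N`, `N = ⌊1/(εT)⌋`) gives, with NO hypothesis beyond «closed box, all 28 forms positive, `T` a period»:
* `abs_translateIntegral_smul_sub_le`, `abs_periodSum_le_harmonic` — the static side at the `σ₁`-scale;
* `abs_phi30_sub_le_harmonic` — `|Φ(s(a)+εδ) − Φ(a)| ≤ ε·σ₁(δ)·(H_N + log(T·x_max+1) + 5) + 7/((N+1)T)`, every `N`;
* **`abs_phi30_sub_le_explicit`** (ray form) — for EVERY `ε > 0` with `εT·Y(δ) ≤ 1`, `ε·Y(δ) ≤ x_min/2` and the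
  displaced direction in the closed box:
  `|Φ(s(a)+εδ) − Φ(a)| ≤ ε·σ₁(δ)·(log⁺(1/(εT)) + log(T·x_max+1) + 6) + 7ε`;
* **`abs_phi30_sub_le_nhds_explicit`** (neighbourhood form) — for EVERY displacement `η` with `0 < Y(η)`,
  `T·Y(η) ≤ 1`, `Y(η) ≤ x_min/2` and `s(a)+η` in the closed box:
  **`|Φ(s(a)+η) − Φ(a)| ≤ σ₁(η)·(log(1/(T·Y(η))) + log(T·x_max+1) + 6) + 7·Y(η)`** — an EXPLICIT TWO-SIDED
  `x·log(1/x)` MODULUS OF CONTINUITY of `Φ` at the rational direction, on the whole range `T·Y ≤ 1` (the covering scale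
  `Y ~ 1/T`, not the coherence scale); `abs_phi30_sub_le_shiftSize_explicit` (`σ₁ ≤ 28Y`);
* **`abs_phi30_sub_le_norm_explicit`** — sup-norm form with absolute constants: for `0 < ‖η‖ ≤ min(1/(2T), x_min/4)`,
  `|Φ(s(a)+η) − Φ(a)| ≤ ‖η‖·(56·log(1/(T‖η‖)) + 56·log(T·x_max+1) + 406)` — `BARRIER-PLAN.md` §2b's displayed S-E
  inequality «`Φ(t) ≤ Φ(t₀) + A‖t−t₀‖(1 + ln⁺(1/(λ₀‖t−t₀‖)))` on `‖t−t₀‖ ≤ ρ(t₀)`» thereby holds in SHAPE and RADIUS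
  as a theorem (two-sidedly, `ρ = min(1/(2T), x_min/4)`) with the explicit no-cancellation constant
  `A = 56·(log(T·x_max+1) + 8)`, which grows like `log T` and is outside the §2b budget — NOT a usable bound, nothing
  certified; S-E's content is the constant (`A` from the signed jump masses, `O(1)` uniformly in the level); S-E / S-E′
  CONJECTURED.
File (2) `ConeGammaLogLipschitzCovering`: at a LATTICE direction of the open box every side condition is automatic on
the ball `Y ≤ 1/(4T)`; `Φ` uniformly on the covering ball; §2b's covering step for `γ` as one explicit inequality.
READING (structure, numbers not adjectives): the MODEL saving is log-Lipschitz at every rational direction with an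
explicit modulus on a ball of radius `≍ 1/T`; by P2 g19's `phi30_diffQuot_tendsto_cuspSlope` the shape `x·log(1/x)` is
ATTAINED wherever a cusp slope is non-zero, so it is the exact local modulus of continuity of `Φ` at rational directions.
NOT here (honest): any cancellation; the size of the true constant (S-E); anything about `γ` (file (2)), C2 or `ζ(5)`.
-/

noncomputable section

open Set MeasureTheory
open scoped Topology

namespace Summit.KontsevichZagierPeriods.Zeta5Search.Barrier.ConeGamma

/-! ### The `σ₁`-gauge and the static side -/

/-- `σ₁` is absolutely homogeneous: `Σ_k |φ_k(t•δ)| = |t|·Σ_k |φ_k(δ)|`. -/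
theorem sum_abs_phiForm_smul (t : ℝ) (δ : Fin 8 → ℝ) :
    ∑ k, |phiForm (t • δ) k| = |t| * ∑ k, |phiForm δ k| := by
  rw [Finset.mul_sum]
  refine Finset.sum_congr rfl fun k _ => ?_
  rw [phiForm_smul, abs_mul]

/-- `σ₁(η) ≤ 28·Y(η)` (28 forms, each `≤ Y`). -/
theorem sum_abs_phiForm_le_shiftSize (η : Fin 8 → ℝ) : ∑ k, |phiForm η k| ≤ 28 * shiftSize η := by
  have h := Finset.sum_le_sum fun k (_ : k ∈ (Finset.univ : Finset (Fin 28))) => abs_phiForm_le_shiftSize η k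
  simp only [Finset.sum_const, Finset.card_univ, Fintype.card_fin, nsmul_eq_mul, Nat.cast_ofNat] at h
  exact h

/-- **THE STATIC TRANSLATE DEFECT AT THE `σ₁`-SCALE**: for all 28 forms of `a` positive, `T ≥ 0` a period and `t ≥ 0`,
`|P(t•δ) − P(0)| ≤ t·(T·σ₁(δ))` (P2 g29's `abs_translateIntegral_sub_le` at `δ′ = 0`). This is «translate dominance with
the no-cancellation constant `A = σ₁(δ)`», valid for EVERY direction and EVERY shift — no radius. -/
theorem abs_translateIntegral_smul_sub_le {a : Dir} (hpos : ∀ k, 0 < h28 a k) {T : ℝ} (hT : 0 ≤ T)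
    (hper : ∀ k : Fin 28, ∃ z : ℤ, T * h28 a k = z) (δ : Fin 8 → ℝ) {t : ℝ} (ht : 0 ≤ t) :
    |translateIntegral a T (t • δ) - translateIntegral a T 0| ≤ t * (T * ∑ k, |phiForm δ k|) := by
  have h := abs_translateIntegral_sub_le hpos hT hper (t • δ) 0
  rw [sub_zero, sum_abs_phiForm_smul, abs_of_nonneg ht] at h
  calc _ ≤ T * (t * ∑ k, |phiForm δ k|) := h
    _ = t * (T * ∑ k, |phiForm δ k|) := by ring

/-- **THE STATIC PERIOD SUM IS AT MOST `ε·σ₁·H_N`.** With `δ_k = (εkT)•δ`: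
`|Σ_{k=1}^{N} (P(δ_k) − P(0))/(kT)²| ≤ ε·σ₁(δ)·H_N` (each term is at most `εkT·Tσ₁/(kT)² = εσ₁/k`). -/
theorem abs_periodSum_le_harmonic {a : Dir} (hpos : ∀ k, 0 < h28 a k) {T : ℝ} (hT : 0 < T)
    (hper : ∀ k : Fin 28, ∃ z : ℤ, T * h28 a k = z) (δ : Fin 8 → ℝ) {ε : ℝ} (hε : 0 ≤ ε) (N : ℕ) :
    |∑ k ∈ Finset.range N, (translateIntegral a T ((ε * (((k : ℝ) + 1) * T)) • δ) - translateIntegral a T 0)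
        / (((k : ℝ) + 1) * T) ^ 2|
      ≤ ε * (∑ i, |phiForm δ i|) * ((harmonic N : ℚ) : ℝ) := by
  rw [harmonic_cast_eq_sum, Finset.mul_sum]
  refine (Finset.abs_sum_le_sum_abs _ _).trans (Finset.sum_le_sum fun k _ => ?_)
  have hk0 : (0 : ℝ) < (k : ℝ) + 1 := Nat.cast_add_one_pos k
  have hkT : 0 < ((k : ℝ) + 1) * T := mul_pos hk0 hT
  have ht : 0 ≤ ε * (((k : ℝ) + 1) * T) := mul_nonneg hε hkT.le
  have h := abs_translateIntegral_smul_sub_le hpos hT.le hper δ ht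
  rw [abs_div, abs_of_pos (pow_pos hkT 2), div_le_iff₀ (pow_pos hkT 2)]
  calc _ ≤ ε * (((k : ℝ) + 1) * T) * (T * ∑ i, |phiForm δ i|) := h
    _ = ε * (∑ i, |phiForm δ i|) * (1 / ((k : ℝ) + 1)) * (((k : ℝ) + 1) * T) ^ 2 := by
        field_simp

/-! ### The modulus of continuity at a rational direction: ray form -/

/-- **`Φ`-DIFFERENCE AGAINST THE HARMONIC NUMBER, HYPOTHESIS-FREE.** `a` in the closed box with all 28 forms positive,
`T > 0` a period, ANY `δ`, ANY `N`, `0 ≤ ε` with `εT·Y(δ) ≤ 1`, `ε·Y(δ) ≤ x_min/2`, the displaced direction in the box: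
`|Φ(s(a)+εδ) − Φ(a)| ≤ ε·σ₁(δ)·(H_N + log(T·x_max+1) + 5) + 7/((N+1)T)` (P2 g20's two-sided identity + the static
period sum at the `σ₁`-scale). -/
theorem abs_phi30_sub_le_harmonic {a : Dir} (ha : BZBox a) (hpos : ∀ k, 0 < h28 a k) {T : ℝ} (hT : 0 < T)
    (hper : ∀ k : Fin 28, ∃ z : ℤ, T * h28 a k = z) (δ : Fin 8 → ℝ) {ε : ℝ} (hε : 0 ≤ ε)
    (hεY : ε * T * shiftSize δ ≤ 1) (hεY2 : ε * shiftSize δ ≤ xMin a / 2)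
    (haε : BZBox (aOfS (sParam a + ε • δ))) (N : ℕ) :
    |phi30 (aOfS (sParam a + ε • δ)) - phi30 a|
      ≤ ε * (∑ i, |phiForm δ i|) * (((harmonic N : ℚ) : ℝ) + Real.log (T * xMax a + 1) + 5)
        + 7 / (((N : ℝ) + 1) * T) := by
  have hid := abs_phi30_sub_sub_periodSum_le ha hpos hT hper δ hε hεY hεY2 haε N
  have hstat := abs_periodSum_le_harmonic hpos hT hper δ hε N
  have key : ∀ D S : ℝ, |D - S| ≤ ε * (∑ i, |phiForm δ i|) * (1 + Real.log (T * xMax a + 1))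
        + 4 * (ε * ∑ i, |phiForm δ i|) + 7 / (((N : ℝ) + 1) * T) →
      |S| ≤ ε * (∑ i, |phiForm δ i|) * ((harmonic N : ℚ) : ℝ) →
      |D| ≤ ε * (∑ i, |phiForm δ i|) * (((harmonic N : ℚ) : ℝ) + Real.log (T * xMax a + 1) + 5)
        + 7 / (((N : ℝ) + 1) * T) := by
    intro D S h1 h2
    have h3 : |D| ≤ |D - S| + |S| := by
      have := abs_add_le (D - S) S; rwa [sub_add_cancel] at this
    have e : ε * (∑ i, |phiForm δ i|) * (1 + Real.log (T * xMax a + 1)) + 4 * (ε * ∑ i, |phiForm δ i|)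
        + 7 / (((N : ℝ) + 1) * T) + ε * (∑ i, |phiForm δ i|) * ((harmonic N : ℚ) : ℝ)
        = ε * (∑ i, |phiForm δ i|) * (((harmonic N : ℚ) : ℝ) + Real.log (T * xMax a + 1) + 5)
          + 7 / (((N : ℝ) + 1) * T) := by ring
    linarith
  exact key _ _ hid hstat

/-- `H_N ≤ 1 + log⁺ x` whenever `N ≤ x` (`H_0 = 0`; `H_N ≤ 1 + log N` for `N ≥ 1`). -/
theorem harmonic_le_one_add_posLog {N : ℕ} {x : ℝ} (hN : (N : ℝ) ≤ x) :
    ((harmonic N : ℚ) : ℝ) ≤ 1 + max (Real.log x) 0 := by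
  rcases Nat.eq_zero_or_pos N with rfl | hN1
  · simp only [harmonic_zero, Rat.cast_zero]
    have := le_max_right (Real.log x) 0
    linarith
  · have h1 := harmonic_le_one_add_log N
    have hNpos : (0 : ℝ) < N := by exact_mod_cast hN1
    have h2 : Real.log N ≤ Real.log x := Real.log_le_log hNpos hN
    have h3 := le_max_left (Real.log x) 0
    linarith

/-- **`Φ` IS LOG-LIPSCHITZ AT A RATIONAL DIRECTION — RAY FORM, EXPLICIT, HYPOTHESIS-FREE.** `a` in the closed box with
all 28 forms positive, `T > 0` a period (`T·h_k(a) ∈ ℤ`), ANY displacement `δ` and EVERY `ε > 0` with `εT·Y(δ) ≤ 1`,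
`ε·Y(δ) ≤ x_min/2` and the displaced direction in the closed box:
`|Φ(s(a)+εδ) − Φ(a)| ≤ ε·σ₁(δ)·(log⁺(1/(εT)) + log(T·x_max+1) + 6) + 7ε`
(`σ₁(δ) = Σ_k |φ_k(δ)|`; `log⁺ = max(log, 0)`; `N = ⌊1/(εT)⌋` in `abs_phi30_sub_le_harmonic`). The whole range
`εT·Y ≤ 1` — the covering scale — not Lemma B's coherence radius; no cancellation is used, so the constants are the
`σ₁`-scale ones, NOT S-E's. -/
theorem abs_phi30_sub_le_explicit {a : Dir} (ha : BZBox a) (hpos : ∀ k, 0 < h28 a k) {T : ℝ} (hT : 0 < T)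
    (hper : ∀ k : Fin 28, ∃ z : ℤ, T * h28 a k = z) (δ : Fin 8 → ℝ) {ε : ℝ} (hε : 0 < ε)
    (hεY : ε * T * shiftSize δ ≤ 1) (hεY2 : ε * shiftSize δ ≤ xMin a / 2)
    (haε : BZBox (aOfS (sParam a + ε • δ))) :
    |phi30 (aOfS (sParam a + ε • δ)) - phi30 a|
      ≤ ε * (∑ i, |phiForm δ i|) * (max (Real.log (1 / (ε * T))) 0 + Real.log (T * xMax a + 1) + 6)
        + 7 * ε := by
  obtain ⟨N, hN⟩ : ∃ N : ℕ, N = ⌊1 / (ε * T)⌋₊ := ⟨_, rfl⟩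
  have hεT : 0 < ε * T := mul_pos hε hT
  have hx0 : 0 ≤ 1 / (ε * T) := (div_pos one_pos hεT).le
  have hNle : (N : ℝ) ≤ 1 / (ε * T) := by rw [hN]; exact Nat.floor_le hx0
  have hNge : 1 / (ε * T) < (N : ℝ) + 1 := by rw [hN]; exact Nat.lt_floor_add_one _
  have hmain := abs_phi30_sub_le_harmonic ha hpos hT hper δ hε.le hεY hεY2 haε N
  have hH := harmonic_le_one_add_posLog hNle
  have hS : 0 ≤ ε * ∑ i, |phiForm δ i| := mul_nonneg hε.le (Finset.sum_nonneg fun i _ => abs_nonneg _)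
  -- the truncation tail: `7/((N+1)T) ≤ 7ε` since `(N+1)·T > 1/ε`
  have htail : 7 / (((N : ℝ) + 1) * T) ≤ 7 * ε := by
    have hNT : 0 < ((N : ℝ) + 1) * T := mul_pos (Nat.cast_add_one_pos N) hT
    rw [div_le_iff₀ hNT]
    have h1 : 1 / (ε * T) * (ε * T) = 1 := by field_simp
    have h2 : 1 ≤ ((N : ℝ) + 1) * (ε * T) := by
      have := mul_le_mul_of_nonneg_right hNge.le hεT.le; rwa [h1] at this
    nlinarith
  have hH' := mul_le_mul_of_nonneg_left hH hS
  calc |phi30 (aOfS (sParam a + ε • δ)) - phi30 a|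
      ≤ ε * (∑ i, |phiForm δ i|) * (((harmonic N : ℚ) : ℝ) + Real.log (T * xMax a + 1) + 5)
        + 7 / (((N : ℝ) + 1) * T) := hmain
    _ = ε * (∑ i, |phiForm δ i|) * ((harmonic N : ℚ) : ℝ)
        + ε * (∑ i, |phiForm δ i|) * (Real.log (T * xMax a + 1) + 5) + 7 / (((N : ℝ) + 1) * T) := by ring
    _ ≤ ε * (∑ i, |phiForm δ i|) * (1 + max (Real.log (1 / (ε * T))) 0)
        + ε * (∑ i, |phiForm δ i|) * (Real.log (T * xMax a + 1) + 5) + 7 * ε := by linarith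
    _ = _ := by ring

/-! ### Neighbourhood form: the modulus of continuity on the covering range -/

/-- **`Φ` IS LOG-LIPSCHITZ AT A RATIONAL DIRECTION — THE EXPLICIT MODULUS OF CONTINUITY (neighbourhood form).** `a` in
the closed box with all 28 forms positive, `T > 0` a period. For EVERY displacement `η` of the symmetric parameters
with `0 < Y(η)`, `T·Y(η) ≤ 1`, `Y(η) ≤ x_min/2` and `s(a) + η` in the closed box:
**`|Φ(s(a)+η) − Φ(a)| ≤ σ₁(η)·(log(1/(T·Y(η))) + log(T·x_max+1) + 6) + 7·Y(η)`**
(`σ₁(η) = Σ_k |φ_k(η)| ≤ 28·Y(η)`). The range `T·Y ≤ 1` is the covering scale `Y ≍ 1/T` of `BARRIER-PLAN.md` §2b —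
NOT Lemma B's coherence ball — and the statement is two-sided and hypothesis-free: an explicit `x·log(1/x)` modulus of
continuity of the MODEL saving at every rational direction (the ray form at `δ = Y(η)⁻¹•η`, `ε = Y(η)`). The constants
are the no-cancellation `σ₁`-scale ones and grow like `log T`; S-E's constant (signed jump masses, `O(1)` uniformly in
the level) is NOT obtained — S-E stays CONJECTURED and nothing is certified at any direction. -/
theorem abs_phi30_sub_le_nhds_explicit {a : Dir} (ha : BZBox a) (hpos : ∀ k, 0 < h28 a k) {T : ℝ} (hT : 0 < T)
    (hper : ∀ k : Fin 28, ∃ z : ℤ, T * h28 a k = z) (η : Fin 8 → ℝ) (hY : 0 < shiftSize η)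
    (hYT : T * shiftSize η ≤ 1) (hYx : shiftSize η ≤ xMin a / 2) (hbox : BZBox (aOfS (sParam a + η))) :
    |phi30 (aOfS (sParam a + η)) - phi30 a|
      ≤ (∑ i, |phiForm η i|) * (Real.log (1 / (T * shiftSize η)) + Real.log (T * xMax a + 1) + 6)
        + 7 * shiftSize η := by
  have hY0 : shiftSize η ≠ 0 := hY.ne'
  have hδ1 : shiftSize ((shiftSize η)⁻¹ • η) = 1 := by
    rw [shiftSize_smul, abs_of_pos (inv_pos.mpr hY), inv_mul_cancel₀ hY0]
  have hηeq : shiftSize η • ((shiftSize η)⁻¹ • η) = η := by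
    rw [smul_smul, mul_inv_cancel₀ hY0, one_smul]
  have hσ : shiftSize η * ∑ i, |phiForm ((shiftSize η)⁻¹ • η) i| = ∑ i, |phiForm η i| := by
    rw [sum_abs_phiForm_smul, abs_of_pos (inv_pos.mpr hY), ← mul_assoc, mul_inv_cancel₀ hY0, one_mul]
  have h1 : shiftSize η * T * shiftSize ((shiftSize η)⁻¹ • η) ≤ 1 := by rw [hδ1, mul_one, mul_comm]; exact hYT
  have h2 : shiftSize η * shiftSize ((shiftSize η)⁻¹ • η) ≤ xMin a / 2 := by rw [hδ1, mul_one]; exact hYx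
  have hmain := abs_phi30_sub_le_explicit ha hpos hT hper ((shiftSize η)⁻¹ • η) hY h1 h2 (by rw [hηeq]; exact hbox)
  rw [hηeq, hσ] at hmain
  have hlog : max (Real.log (1 / (shiftSize η * T))) 0 = Real.log (1 / (T * shiftSize η)) := by
    rw [mul_comm, max_eq_left]
    refine Real.log_nonneg ?_
    rw [le_div_iff₀ (mul_pos hT hY)]; linarith
  rwa [hlog] at hmain

/-- **The modulus in the form gauge alone** (`σ₁ ≤ 28Y`): under the same hypotheses,
`|Φ(s(a)+η) − Φ(a)| ≤ Y(η)·(28·log(1/(T·Y(η))) + 28·log(T·x_max+1) + 175)`. -/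
theorem abs_phi30_sub_le_shiftSize_explicit {a : Dir} (ha : BZBox a) (hpos : ∀ k, 0 < h28 a k) {T : ℝ}
    (hT : 0 < T) (hper : ∀ k : Fin 28, ∃ z : ℤ, T * h28 a k = z) (η : Fin 8 → ℝ) (hY : 0 < shiftSize η)
    (hYT : T * shiftSize η ≤ 1) (hYx : shiftSize η ≤ xMin a / 2) (hbox : BZBox (aOfS (sParam a + η))) :
    |phi30 (aOfS (sParam a + η)) - phi30 a|
      ≤ shiftSize η * (28 * Real.log (1 / (T * shiftSize η)) + 28 * Real.log (T * xMax a + 1) + 175) := by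
  have h := abs_phi30_sub_le_nhds_explicit ha hpos hT hper η hY hYT hYx hbox
  have hσ := sum_abs_phiForm_le_shiftSize η
  have hlog : 0 ≤ Real.log (1 / (T * shiftSize η)) := by
    refine Real.log_nonneg ?_
    rw [le_div_iff₀ (mul_pos hT hY)]; linarith
  have hlog2 : 0 ≤ Real.log (T * xMax a + 1) := by
    refine Real.log_nonneg ?_
    have := mul_pos hT (xMax_pos hpos); linarith
  have hfac : 0 ≤ Real.log (1 / (T * shiftSize η)) + Real.log (T * xMax a + 1) + 6 := by linarith
  have := mul_le_mul_of_nonneg_right hσ hfac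
  linarith

/-! ### Sup-norm form: S-E's upper-modulus inequality with an explicit no-cancellation constant -/

/-- `log(5/2) ≤ 1`. -/
theorem log_five_halves_le_one : Real.log (5 / 2) ≤ 1 := by
  have h : (5 : ℝ) / 2 ≤ Real.exp 1 := by
    have := Real.exp_one_gt_d9; linarith
  calc Real.log (5 / 2) ≤ Real.log (Real.exp 1) := Real.log_le_log (by norm_num) h
    _ = 1 := Real.log_exp 1

/-- **S-E's UPPER-MODULUS INEQUALITY WITH AN EXPLICIT NO-CANCELLATION CONSTANT (two-sided, sup norm).** `a` in the
closed box with all 28 forms positive, `T > 0` a period. For EVERY displacement `η` with `0 < ‖η‖`, `T·‖η‖ ≤ 1/2`,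
`‖η‖ ≤ x_min/4` (sup norm of `ℝ⁸`) and `s(a) + η` in the closed box:
**`|Φ(s(a)+η) − Φ(a)| ≤ ‖η‖·(56·log(1/(T‖η‖)) + 56·log(T·x_max+1) + 406)`**.
So the displayed inequality of `BARRIER-PLAN.md` §2b (S-E, upper modulus) «`Φ(t) ≤ Φ(t₀) + A‖t−t₀‖·(1 +
ln⁺(1/(λ₀‖t−t₀‖)))` for `‖t−t₀‖ ≤ ρ(t₀)`» holds in SHAPE and RADIUS as a theorem (two-sidedly, `ρ = min(1/(2T),
x_min/4)`) with the explicit no-cancellation constant `A = 56·(log(T·x_max+1) + 8)` (`σ₁ ≤ 56‖η‖`), which grows like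
`log T` and is outside the §2b budget — NOT a usable bound, nothing certified at any direction; S-E's content is the
constant (`A` from the signed jump masses, `O(1)` uniformly in the level); S-E / S-E′ CONJECTURED; nothing about `γ`,
C2 or `ζ(5)`. -/
theorem abs_phi30_sub_le_norm_explicit {a : Dir} (ha : BZBox a) (hpos : ∀ k, 0 < h28 a k) {T : ℝ} (hT : 0 < T)
    (hper : ∀ k : Fin 28, ∃ z : ℤ, T * h28 a k = z) (η : Fin 8 → ℝ) (hη : 0 < ‖η‖) (hηT : T * ‖η‖ ≤ 1 / 2)
    (hηx : ‖η‖ ≤ xMin a / 4) (hbox : BZBox (aOfS (sParam a + η))) :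
    |phi30 (aOfS (sParam a + η)) - phi30 a|
      ≤ ‖η‖ * (56 * Real.log (1 / (T * ‖η‖)) + 56 * Real.log (T * xMax a + 1) + 406) := by
  have hYle := shiftSize_le_two_mul_norm η
  have hYge := norm_le_shiftSize η
  have hY : 0 < shiftSize η := by linarith
  have hYT : T * shiftSize η ≤ 1 := by nlinarith
  have hYx : shiftSize η ≤ xMin a / 2 := by linarith
  have h := abs_phi30_sub_le_nhds_explicit ha hpos hT hper η hY hYT hYx hbox
  have hσ : ∑ i, |phiForm η i| ≤ 56 * ‖η‖ := sum_abs_phiForm_le η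
  have hTη : 0 < T * ‖η‖ := mul_pos hT hη
  -- `log(1/(T·Y)) ≤ log(1/(T‖η‖)) + log(5/2) ≤ log(1/(T‖η‖)) + 1`
  have hlogY : Real.log (1 / (T * shiftSize η)) ≤ Real.log (1 / (T * ‖η‖)) + 1 := by
    have h1 : 1 / (T * shiftSize η) ≤ (1 / (T * ‖η‖)) * (5 / 2) := by
      rw [div_mul_eq_mul_div, one_mul, div_le_div_iff₀ (mul_pos hT hY) hTη]
      nlinarith
    calc Real.log (1 / (T * shiftSize η)) ≤ Real.log ((1 / (T * ‖η‖)) * (5 / 2)) :=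
          Real.log_le_log (div_pos one_pos (mul_pos hT hY)) h1
      _ = Real.log (1 / (T * ‖η‖)) + Real.log (5 / 2) :=
          Real.log_mul (div_pos one_pos hTη).ne' (by norm_num)
      _ ≤ _ := by linarith [log_five_halves_le_one]
  have hlog0 : 0 ≤ Real.log (1 / (T * shiftSize η)) := by
    refine Real.log_nonneg ?_
    rw [le_div_iff₀ (mul_pos hT hY)]; linarith
  have hlog1 : 0 ≤ Real.log (1 / (T * ‖η‖)) := by
    refine Real.log_nonneg ?_
    rw [le_div_iff₀ hTη]; linarith
  have hlog2 : 0 ≤ Real.log (T * xMax a + 1) := by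
    refine Real.log_nonneg ?_
    have := mul_pos hT (xMax_pos hpos); linarith
  have hσ0 : 0 ≤ ∑ i, |phiForm η i| := Finset.sum_nonneg fun i _ => abs_nonneg _
  -- `σ₁·(log + L + 6) ≤ 56‖η‖·(log(1/(T‖η‖)) + 1 + L + 6)`
  have hA : (∑ i, |phiForm η i|) * (Real.log (1 / (T * shiftSize η)) + Real.log (T * xMax a + 1) + 6)
      ≤ 56 * ‖η‖ * (Real.log (1 / (T * ‖η‖)) + 1 + Real.log (T * xMax a + 1) + 6) := by
    have h1 : (∑ i, |phiForm η i|) * (Real.log (1 / (T * shiftSize η)) + Real.log (T * xMax a + 1) + 6)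
        ≤ (∑ i, |phiForm η i|) * (Real.log (1 / (T * ‖η‖)) + 1 + Real.log (T * xMax a + 1) + 6) :=
      mul_le_mul_of_nonneg_left (by linarith) hσ0
    have h2 := mul_le_mul_of_nonneg_right hσ
      (show 0 ≤ Real.log (1 / (T * ‖η‖)) + 1 + Real.log (T * xMax a + 1) + 6 by linarith)
    exact h1.trans h2
  have e : 56 * ‖η‖ * (Real.log (1 / (T * ‖η‖)) + 1 + Real.log (T * xMax a + 1) + 6) + 7 * (2 * ‖η‖)
      = ‖η‖ * (56 * Real.log (1 / (T * ‖η‖)) + 56 * Real.log (T * xMax a + 1) + 406) := by ring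
  nlinarith

end Summit.KontsevichZagierPeriods.Zeta5Search.Barrier.ConeGamma

end
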